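import Summits.ABC.ABC.Theses.PadicPrimesKummerThird
import Summits.ABC.StewartYu.KummerThirdDoor

set_option linter.dupNamespace false

/-!
# Route PadicPrimesKummerThird (rung F-A1 = Stewart–Yu 2001, `log c ≪ rad^{1/3}(log rad)^3`):
# the support item `KummerDoor` (stmt-ABC-19660)

`Summits/ABC/ABC/Theorems/PadicPrimesKummerThirdKummerDoor.lean` — cell `abc-stewartyu`, seat p3 (g4).
The door `Y07Odd → Y07Two → BakerMethodBounds` is the cell-side theorem
`Summit.ABC.StewartYu.KummerThird.BakerMethodBounds_of_y07` (p3-g3, `Summits/ABC/StewartYu/KummerThirdDoor.lean`: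
the two prime-class `p`-adic texts give the two place bounds `placeBound_a_of_y07At` /
`placeBound_c_of_y07At` in `θ`-currency, which feed the place-bounds re-run of file VI
`Literature.Barriers.ABC.BakerMethodBounds_of_placeBounds_kummerArchBound₂` with `K := max 4 C`, the door
constant `w80Cw` and the tree theorem `waldschmidt1980_hW₂` for the archimedean binder), whose two
hypotheses are the crux texts `Y07Odd` / `Y07Two` verbatim.  [folklore] composition.
WHAT THIS IS NOT: the two engine cruxes `Y07Odd` (stmt-ABC-19658) / `Y07Two` (stmt-ABC-19659) are untouched.
-/

namespace Summit.ABC.ABC.Theorems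

/-- **Item stmt-ABC-19660 `KummerDoor`** of route `PadicPrimesKummerThird`: `Y07Odd → Y07Two →
Literature.Barriers.ABC.BakerMethodBounds`, by p3-g3's `KummerThird.BakerMethodBounds_of_y07`
(place bounds at the primes of `a` and of `c` + file VI re-run + Waldschmidt 1980). [folklore] -/
theorem padicPrimesKummerThird_kummerDoor_proof :
    Summit.ABC.ABC.Theses.PadicPrimesKummerThird.KummerDoor :=
  fun h₁ h₂ => Summit.ABC.StewartYu.KummerThird.BakerMethodBounds_of_y07 h₁ h₂

end Summit.ABC.ABC.Theorems
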